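import Summits.KontsevichZagierPeriods.KontsevichZagierPeriods.Theorems.PentagonInKZ.Negative.WeightThreeShape

/-!
# `PentagonInKZ` — negative lane, §16c–d: the level-3 pentagon is `(χ⟦ζ(2,1)⟧ - χ⟦ζ(3)⟧)·D[U] = 0`;
# tightness modulo weight 4

Standing adversary (cdisprove seat, generation 3) on the crux `PentagonInKZ`
(stmt-KontsevichZagierPeriods-11348).

* §16c For ANY series `φ` of Lie shape in weight `≤ 3` over a commutative ring, the level-3
  pentagon identity `PentAt φ 3` in `U𝔞₄ ⊗ R/(deg > 3)` is LINEAR: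
  `c·D[K₂] + p·D[U] + q·D[V] = 0` (`pentAt_three_iff_of_shape`; products of the weight-`≥ 2`
  parts vanish), where `D[K]` is the signed sum of `K(Aᵢ,Bᵢ)` over the five pentagon
  substitutions; `D[K₂] = 0` identically (locality, `pentD_K₂_eq_zero`) and **`D[U] = D[V]`**
  (`pentD_KU_eq_KV`) — read off from Drinfeld's theorem for `Φ_KZ` over `ℝ` (`p = -ζ(3)`,
  `q = ζ(2,1) = ζ(3) ≠ 0`) and transported to every `ℚ`-algebra by injectivity of base change
  (`DrinfeldKohnoTrunc.map_injective`).  Hence `PentAt φ 3 ⟸ c_{xxy} + c_{xyy} = 0`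
  (`pentAt_three_of_shape`, converse of `DrinfeldPentagon.apply_weight_three` at level 3).
* §16d For the crux series in every realisation: `PentAt Φ_χ 3 ↔ (χ⟦ζ(2,1)⟧ - χ⟦ζ(3)⟧)·D[U] = 0`
  (`cruxSeries_pentAt_three_iff`); duality at weight 3 gives the pentagon in all levels `≤ 3`
  (`pentAt_le_three_of_duality`); and **given the provable-now support item `DualityInKZ` the
  crux holds unconditionally modulo weight 4** (`pentAt_le_three_of_dualityInKZ`): the first rung
  where `PentagonInKZ` can fail, or needs a genuinely two-dimensional move, is weight 4
  (`weight_four_content`: the stuffle / `5⟦ζ(4)⟧ = 2⟦ζ(2)⟧²`).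
-/

noncomputable section

open Literature.NumberTheory.Transcendental

namespace Summit.KontsevichZagierPeriods.FurushoPentagon.PentagonInKZNegative

open Summit.KontsevichZagierPeriods.KontsevichZagierPeriods.Theses.FurushoPentagon (PentagonInKZ)

/-! ## §16c The level-3 pentagon identity: reduction to two elements of `U𝔞₄/(deg > 3)` -/

section DK

open DrinfeldKohnoTrunc

variable {R : Type} [CommRing R] {N : ℕ}

/-- The commutator `[A, B]`. [folklore] -/
def K₂ (A B : DrinfeldKohnoTrunc R (Fin 4) N) : DrinfeldKohnoTrunc R (Fin 4) N := A * B - B * A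

/-- `[A, [A, B]] = AAB - 2ABA + BAA`. [folklore] -/
def KU (A B : DrinfeldKohnoTrunc R (Fin 4) N) : DrinfeldKohnoTrunc R (Fin 4) N :=
  A * A * B - A * B * A - A * B * A + B * A * A

/-- `[[A, B], B] = ABB - 2BAB + BBA`. [folklore] -/
def KV (A B : DrinfeldKohnoTrunc R (Fin 4) N) : DrinfeldKohnoTrunc R (Fin 4) N :=
  A * B * B - B * A * B - B * A * B + B * B * A

variable (R N) in
/-- **The pentagon defect functional**: signed sum of `K(Aᵢ, Bᵢ)` over the five substitutions of
Drinfeld's pentagon (`+` for the two left factors, `-` for the three right factors).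
[cite: Furusho2011, §2 (pentagon)] -/
def pentD (K : DrinfeldKohnoTrunc R (Fin 4) N → DrinfeldKohnoTrunc R (Fin 4) N →
    DrinfeldKohnoTrunc R (Fin 4) N) : DrinfeldKohnoTrunc R (Fin 4) N :=
  K (t R N 0 1) (t R N 1 2 + t R N 1 3) + K (t R N 0 2 + t R N 1 2) (t R N 2 3) -
    K (t R N 1 2) (t R N 2 3) - K (t R N 0 1 + t R N 0 2) (t R N 1 3 + t R N 2 3) -
    K (t R N 0 1) (t R N 1 2)

/-- **The weight-2 defect vanishes identically** (`[t₀₁,t₂₃] = [t₀₂,t₁₃] = 0` by locality), in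
every truncation level. [cite: Furusho2011, §2] -/
theorem pentD_K₂_eq_zero : pentD R N K₂ = 0 := by
  simp only [pentD, K₂]
  have l1 : (t R N 0 1 * t R N 2 3 : DrinfeldKohnoTrunc R (Fin 4) N) = t R N 2 3 * t R N 0 1 :=
    t_comm 0 1 2 3 (by decide) (by decide) (by decide) (by decide) (by decide) (by decide)
  have l2 : (t R N 0 2 * t R N 1 3 : DrinfeldKohnoTrunc R (Fin 4) N) = t R N 1 3 * t R N 0 2 :=
    t_comm 0 2 1 3 (by decide) (by decide) (by decide) (by decide) (by decide) (by decide)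
  refine Eq.trans (b := -(t R N 0 1 * t R N 2 3 - t R N 2 3 * t R N 0 1) -
      (t R N 0 2 * t R N 1 3 - t R N 1 3 * t R N 0 2)) ?_ ?_
  · noncomm_ring
  · rw [l1, l2, sub_self, sub_self, neg_zero, sub_zero]

/-- The defect functionals are natural under change of scalars. [folklore] -/
theorem map_pentD_KU {S : Type} [CommRing S] (f : R →+* S) :
    DrinfeldKohnoTrunc.map f (pentD R N KU) = pentD S N KU := by
  simp only [pentD, KU, map_sub, map_add, map_mul, DrinfeldKohnoTrunc.map_t]

/-- The defect functionals are natural under change of scalars. [folklore] -/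
theorem map_pentD_KV {S : Type} [CommRing S] (f : R →+* S) :
    DrinfeldKohnoTrunc.map f (pentD R N KV) = pentD S N KV := by
  simp only [pentD, KV, map_sub, map_add, map_mul, DrinfeldKohnoTrunc.map_t]

/-- The generators are weight-one. [folklore] -/
theorem t_mem_wFil_one' (i j : Fin 4) :
    t R N i j ∈ (wFil 1 : Submodule R (DrinfeldKohnoTrunc R (Fin 4) N)) :=
  mem_wFil_one_of_mem_genSpan (t_mem_genSpan i j)

/-- Products of two weight-one elements have weight `≥ 2`. [folklore] -/
theorem mul_mem_wFil_two' {X Y : DrinfeldKohnoTrunc R (Fin 4) N}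
    (hX : X ∈ (wFil 1 : Submodule R (DrinfeldKohnoTrunc R (Fin 4) N)))
    (hY : Y ∈ (wFil 1 : Submodule R (DrinfeldKohnoTrunc R (Fin 4) N))) :
    X * Y ∈ (wFil 2 : Submodule R (DrinfeldKohnoTrunc R (Fin 4) N)) := by
  have h := mul_mem_wFil hX hY
  exact h

/-- Products of three weight-one elements have weight `≥ 2`. [folklore] -/
theorem mul_mul_mem_wFil_two {X Y W : DrinfeldKohnoTrunc R (Fin 4) N}
    (hX : X ∈ (wFil 1 : Submodule R (DrinfeldKohnoTrunc R (Fin 4) N)))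
    (hY : Y ∈ (wFil 1 : Submodule R (DrinfeldKohnoTrunc R (Fin 4) N)))
    (hW : W ∈ (wFil 1 : Submodule R (DrinfeldKohnoTrunc R (Fin 4) N))) :
    X * Y * W ∈ (wFil 2 : Submodule R (DrinfeldKohnoTrunc R (Fin 4) N)) := by
  have h3 := mul_mem_wFil (mul_mem_wFil hX hY) hW
  exact wFil_antitone (m := 2) (n := 1 + 1 + 1) (by norm_num) h3

/-- The Lie-shape combination `c[A,B] + p[A,[A,B]] + q[[A,B],B]` of weight-one `A, B` has weight
`≥ 2`. [folklore] -/
theorem shape_mem_wFil_two (c p q : R) {A B : DrinfeldKohnoTrunc R (Fin 4) N}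
    (hA : A ∈ (wFil 1 : Submodule R (DrinfeldKohnoTrunc R (Fin 4) N)))
    (hB : B ∈ (wFil 1 : Submodule R (DrinfeldKohnoTrunc R (Fin 4) N))) :
    c • K₂ A B + p • KU A B + q • KV A B ∈ (wFil 2 : Submodule R (DrinfeldKohnoTrunc R (Fin 4) N)) := by
  refine Submodule.add_mem _ (Submodule.add_mem _ (Submodule.smul_mem _ _ ?_)
    (Submodule.smul_mem _ _ ?_)) (Submodule.smul_mem _ _ ?_)
  · exact Submodule.sub_mem _ (mul_mem_wFil_two' hA hB) (mul_mem_wFil_two' hB hA)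
  · exact Submodule.add_mem _ (Submodule.sub_mem _ (Submodule.sub_mem _
      (mul_mul_mem_wFil_two hA hA hB) (mul_mul_mem_wFil_two hA hB hA))
      (mul_mul_mem_wFil_two hA hB hA)) (mul_mul_mem_wFil_two hB hA hA)
  · exact Submodule.add_mem _ (Submodule.sub_mem _ (Submodule.sub_mem _
      (mul_mul_mem_wFil_two hA hB hB) (mul_mul_mem_wFil_two hB hA hB))
      (mul_mul_mem_wFil_two hB hA hB)) (mul_mul_mem_wFil_two hB hB hA)

/-- `(1 + u)(1 + v) = 1 + u + v` at level `3` for `u, v` of weight `≥ 2`. [folklore] -/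
theorem one_add_mul_one_add {u v : DrinfeldKohnoTrunc R (Fin 4) 3}
    (hu : u ∈ (wFil 2 : Submodule R (DrinfeldKohnoTrunc R (Fin 4) 3)))
    (hv : v ∈ (wFil 2 : Submodule R (DrinfeldKohnoTrunc R (Fin 4) 3))) :
    (1 + u) * (1 + v) = 1 + (u + v) := by
  rw [mul_add, add_mul, add_mul, one_mul, mul_one, one_mul,
    mul_eq_zero_of_wFil (show 3 < 2 + 2 by norm_num) hu hv, add_zero, add_assoc]

/-- `(1 + u)(1 + v)(1 + w) = 1 + u + v + w` at level `3` for `u, v, w` of weight `≥ 2`. [folklore] -/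
theorem one_add_mul_one_add_mul_one_add {u v w : DrinfeldKohnoTrunc R (Fin 4) 3}
    (hu : u ∈ (wFil 2 : Submodule R (DrinfeldKohnoTrunc R (Fin 4) 3)))
    (hv : v ∈ (wFil 2 : Submodule R (DrinfeldKohnoTrunc R (Fin 4) 3)))
    (hw : w ∈ (wFil 2 : Submodule R (DrinfeldKohnoTrunc R (Fin 4) 3))) :
    (1 + u) * (1 + v) * (1 + w) = 1 + (u + v + w) := by
  rw [one_add_mul_one_add hu hv, one_add_mul_one_add (Submodule.add_mem _ hu hv) hw, add_assoc]

/-- **The level-3 pentagon identity for a series of Lie shape in weight `≤ 3` is LINEAR**: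
`PentAt φ 3 ↔ c · D[K₂] + p · D[U] + q · D[V] = 0` in `U𝔞₄ ⊗ R/(deg > 3)`, where `D[·]` is the
pentagon defect functional (products of two factors `φ(Aᵢ,Bᵢ) - 1 ∈ wFil 2` vanish at level 3).
[cite: BarNatan1998, §3 (linearised pentagon)] -/
theorem pentAt_three_iff_of_shape {φ : NCSeries Bool R} (hφ : φ [] = 1) (h0 : φ [false] = 0)
    (h1 : φ [true] = 0) (hff : φ [false, false] = 0) (htt : φ [true, true] = 0)
    (htf : φ [true, false] = -φ [false, true]) (hfff : φ [false, false, false] = 0)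
    (httt : φ [true, true, true] = 0) (hftf : φ [false, true, false] = -2 * φ [false, false, true])
    (htff : φ [true, false, false] = φ [false, false, true])
    (htft : φ [true, false, true] = -2 * φ [false, true, true])
    (httf : φ [true, true, false] = φ [false, true, true]) :
    NCSeries.PentAt φ 3 ↔ φ [false, true] • pentD R 3 K₂ + φ [false, false, true] • pentD R 3 KU +
      φ [false, true, true] • pentD R 3 KV = 0 := by
  have hexp : ∀ A B : DrinfeldKohnoTrunc R (Fin 4) 3, NCSeries.evalTrunc 3 (NCSeries.bsub A B) φ =
      1 + (φ [false, true] • K₂ A B + φ [false, false, true] • KU A B +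
        φ [false, true, true] • KV A B) := fun A B => by
    rw [evalTrunc_three_of_shape hφ h0 h1 hff htt htf hfff httt hftf htff htft httf, K₂, KU, KV]
    abel
  have hg : ∀ i j : Fin 4, t R 3 i j ∈ (wFil 1 : Submodule R (DrinfeldKohnoTrunc R (Fin 4) 3)) :=
    t_mem_wFil_one'
  have hadd : ∀ {A B : DrinfeldKohnoTrunc R (Fin 4) 3},
      A ∈ (wFil 1 : Submodule R (DrinfeldKohnoTrunc R (Fin 4) 3)) →
      B ∈ (wFil 1 : Submodule R (DrinfeldKohnoTrunc R (Fin 4) 3)) →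
      A + B ∈ (wFil 1 : Submodule R (DrinfeldKohnoTrunc R (Fin 4) 3)) := fun hA hB =>
    Submodule.add_mem _ hA hB
  have hm := fun {A B : DrinfeldKohnoTrunc R (Fin 4) 3}
    (hA : A ∈ (wFil 1 : Submodule R (DrinfeldKohnoTrunc R (Fin 4) 3)))
    (hB : B ∈ (wFil 1 : Submodule R (DrinfeldKohnoTrunc R (Fin 4) 3))) =>
    shape_mem_wFil_two (φ [false, true]) (φ [false, false, true]) (φ [false, true, true]) hA hB
  dsimp only [NCSeries.PentAt, NCSeries.subst₂, NCSeries.t₄]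
  rw [hexp, hexp, hexp, hexp, hexp,
    one_add_mul_one_add (hm (hg 0 1) (hadd (hg 1 2) (hg 1 3))) (hm (hadd (hg 0 2) (hg 1 2)) (hg 2 3)),
    one_add_mul_one_add_mul_one_add (hm (hg 1 2) (hg 2 3))
      (hm (hadd (hg 0 1) (hg 0 2)) (hadd (hg 1 3) (hg 2 3))) (hm (hg 0 1) (hg 1 2)),
    add_right_inj, ← sub_eq_zero]
  have key : φ [false, true] • K₂ (t R 3 0 1) (t R 3 1 2 + t R 3 1 3) +
      φ [false, false, true] • KU (t R 3 0 1) (t R 3 1 2 + t R 3 1 3) +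
      φ [false, true, true] • KV (t R 3 0 1) (t R 3 1 2 + t R 3 1 3) +
      (φ [false, true] • K₂ (t R 3 0 2 + t R 3 1 2) (t R 3 2 3) +
        φ [false, false, true] • KU (t R 3 0 2 + t R 3 1 2) (t R 3 2 3) +
        φ [false, true, true] • KV (t R 3 0 2 + t R 3 1 2) (t R 3 2 3)) -
      (φ [false, true] • K₂ (t R 3 1 2) (t R 3 2 3) + φ [false, false, true] • KU (t R 3 1 2) (t R 3 2 3) +
        φ [false, true, true] • KV (t R 3 1 2) (t R 3 2 3) +
        (φ [false, true] • K₂ (t R 3 0 1 + t R 3 0 2) (t R 3 1 3 + t R 3 2 3) +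
          φ [false, false, true] • KU (t R 3 0 1 + t R 3 0 2) (t R 3 1 3 + t R 3 2 3) +
          φ [false, true, true] • KV (t R 3 0 1 + t R 3 0 2) (t R 3 1 3 + t R 3 2 3)) +
        (φ [false, true] • K₂ (t R 3 0 1) (t R 3 1 2) + φ [false, false, true] • KU (t R 3 0 1) (t R 3 1 2) +
          φ [false, true, true] • KV (t R 3 0 1) (t R 3 1 2))) =
      φ [false, true] • pentD R 3 K₂ + φ [false, false, true] • pentD R 3 KU +
        φ [false, true, true] • pentD R 3 KV := by
    simp only [pentD, smul_add, smul_sub]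
    abel
  rw [key]

/-- **`D[U] = D[V]` at level 3 over `ℝ`** — read off from Drinfeld's theorem: `Φ_KZ` has Lie shape
with `p = -ζ(3)`, `q = ζ(2,1) = ζ(3)` (Euler, itself the weight-3 consequence of the pentagon), so
its level-3 pentagon identity says `ζ(3) · (D[V] - D[U]) = 0`, and `ζ(3) ≠ 0`. [cite: Drinfeld1991, (2.13)] -/
theorem pentD_KU_eq_KV_real : pentD ℝ 3 KU = pentD ℝ 3 KV := by
  set φ := cruxSeries ℝ KZ.eval simplexZ with hφdef
  have hpent : NCSeries.DrinfeldPentagon φ := by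
    rw [hφdef, cruxSeries_eval_eq_drinfeldAssociator simplexZ_agrees]
    exact drinfeldAssociator_pentagon_holds
  have h0 : φ [] = 1 := cruxSeries_nil_eq_one KZ.eval simplexZ isRealisation_eval simplexZ_agrees
  have hx : φ [false] = 0 := cruxSeries_x _ _
  have hy : φ [true] = 0 := cruxSeries_y _ _
  have h3 := NCSeries.DrinfeldPentagon.apply_weight_three hpent h0 hx hy
  have hlin := (pentAt_three_iff_of_shape h0 hx hy (cruxSeries_xx _ _) (cruxSeries_yy _ _)
    (by rw [hφdef, cruxSeries_yx, cruxSeries_xy, neg_neg]) (cruxSeries_xxx _ _) (cruxSeries_yyy _ _)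
    (by rw [hφdef, cruxSeries_xyx, cruxSeries_xxy]; ring) (by rw [hφdef, cruxSeries_yxx, cruxSeries_xxy])
    (by rw [hφdef, cruxSeries_yxy, cruxSeries_xyy])
    (by rw [hφdef, cruxSeries_yyx, cruxSeries_xyy])).mp (hpent 3)
  rw [pentD_K₂_eq_zero, smul_zero, zero_add] at hlin
  rw [hφdef, cruxSeries_xxy, cruxSeries_xyy] at h3 hlin
  -- `eval Z[2,1] = eval Z[3]`, and `eval Z[3] = ζ(3) > 0`
  have h21 : KZ.eval (simplexZ [2, 1]) = KZ.eval (simplexZ [3]) := by linear_combination h3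
  have hpos : 0 < KZ.eval (simplexZ [3]) := by
    rw [simplexZ_agrees [3] (by decide), KZ.eval_of, KZ.mzvRep_value_holds]
    exact multipleZeta_pos_of_isAdmissible_holds (by decide)
  rw [h21, neg_smul, neg_add_eq_zero, eq_comm] at hlin
  -- hlin : ζ(3) • D[V] = ζ(3) • D[U]
  have := congrArg (fun x => (KZ.eval (simplexZ [3]))⁻¹ • x) hlin
  simpa only [inv_smul_smul₀ hpos.ne'] using this.symm

/-- **`D[U] = D[V]` at level 3 over every commutative `ℚ`-algebra** (from `ℝ` to `ℚ` by
injectivity of base change `U𝔞₄ ⊗ ℚ → U𝔞₄ ⊗ ℝ`, then to `R` by functoriality). [folklore] -/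
theorem pentD_KU_eq_KV (R : Type) [CommRing R] [Algebra ℚ R] : pentD R 3 KU = pentD R 3 KV := by
  have hq : pentD ℚ 3 KU = pentD ℚ 3 KV := by
    apply DrinfeldKohnoTrunc.map_injective (Fin 4) 3 (algebraMap ℚ ℝ).injective
    rw [map_pentD_KU, map_pentD_KV]
    exact pentD_KU_eq_KV_real
  have h := congrArg (DrinfeldKohnoTrunc.map (ι := Fin 4) (N := 3) (algebraMap ℚ R)) hq
  rwa [map_pentD_KU, map_pentD_KV] at h

/-- **The level-3 pentagon holds for every series of Lie shape in weight `≤ 3` with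
`c_{xxy} + c_{xyy} = 0`** (no other hypothesis: the defect is `(p + q) · D[U]`). Converse of
`NCSeries.DrinfeldPentagon.apply_weight_three` at level 3. [cite: BarNatan1998, §3] -/
theorem pentAt_three_of_shape {R : Type} [CommRing R] [Algebra ℚ R] {φ : NCSeries Bool R}
    (hφ : φ [] = 1) (h0 : φ [false] = 0)
    (h1 : φ [true] = 0) (hff : φ [false, false] = 0) (htt : φ [true, true] = 0)
    (htf : φ [true, false] = -φ [false, true]) (hfff : φ [false, false, false] = 0)
    (httt : φ [true, true, true] = 0) (hftf : φ [false, true, false] = -2 * φ [false, false, true])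
    (htff : φ [true, false, false] = φ [false, false, true])
    (htft : φ [true, false, true] = -2 * φ [false, true, true])
    (httf : φ [true, true, false] = φ [false, true, true])
    (hpq : φ [false, false, true] + φ [false, true, true] = 0) : NCSeries.PentAt φ 3 := by
  rw [pentAt_three_iff_of_shape hφ h0 h1 hff htt htf hfff httt hftf htff htft httf,
    pentD_K₂_eq_zero, smul_zero, zero_add, pentD_KU_eq_KV, ← add_smul, hpq, zero_smul]

end DK

/-! ## §16d The crux modulo weight 4: duality at weight 3 is exactly what is needed -/

section Crux

open Summit.KontsevichZagierPeriods.KontsevichZagierPeriods.Theses.FurushoPentagon (DualityInKZ)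

variable {R : Type} [CommRing R] [Algebra ℚ R] {χ : KZ.FormalRep →+ R} {Z : List ℕ → KZ.FormalRep}

/-- **The level-3 pentagon identity of the crux series, in EVERY realisation, is
`(χ⟦ζ(2,1)⟧ - χ⟦ζ(3)⟧) · D[U] = 0`** (Lie shape by regularisation algebra alone; `D[K₂] = 0` by
locality; `D[U] = D[V]` from Drinfeld's theorem). [cite: Furusho2011, §2] -/
theorem cruxSeries_pentAt_three_iff (hχ : IsRealisation R χ) (hZ : AgreesWithSimplex Z) :
    NCSeries.PentAt (cruxSeries R χ Z) 3 ↔ (χ (Z [2, 1]) - χ (Z [3])) • pentD R 3 KU = 0 := by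
  rw [pentAt_three_iff_of_shape (cruxSeries_nil_eq_one χ Z hχ hZ) (cruxSeries_x χ Z)
    (cruxSeries_y χ Z) (cruxSeries_xx χ Z) (cruxSeries_yy χ Z)
    (by rw [cruxSeries_yx, cruxSeries_xy, neg_neg]) (cruxSeries_xxx χ Z) (cruxSeries_yyy χ Z)
    (by rw [cruxSeries_xyx, cruxSeries_xxy]; ring) (by rw [cruxSeries_yxx, cruxSeries_xxy])
    (by rw [cruxSeries_yxy, cruxSeries_xyy]) (by rw [cruxSeries_yyx, cruxSeries_xyy]),
    pentD_K₂_eq_zero, smul_zero, zero_add, pentD_KU_eq_KV R, ← add_smul, cruxSeries_xxy,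
    cruxSeries_xyy, neg_add_eq_sub]

/-- **Duality at weight 3 in a realisation gives the level-3 pentagon there.** [cite: Furusho2011, §2] -/
theorem cruxSeries_pentAt_three_of_duality (hχ : IsRealisation R χ) (hZ : AgreesWithSimplex Z)
    (h : χ (Z [3]) = χ (Z [2, 1])) : NCSeries.PentAt (cruxSeries R χ Z) 3 := by
  rw [cruxSeries_pentAt_three_iff hχ hZ, h, sub_self, zero_smul]

/-- **TIGHTNESS, second rung**: if `χ⟦ζ(3)⟧ = χ⟦ζ(2,1)⟧` then the pentagon identity for `Φ_χ`
holds in ALL truncations `N ≤ 3` (levels `≤ 2` unconditionally, `pentAt_le_two`). [cite: Furusho2011, §2] -/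
theorem pentAt_le_three_of_duality (hχ : IsRealisation R χ) (hZ : AgreesWithSimplex Z)
    (h : χ (Z [3]) = χ (Z [2, 1])) : ∀ N ≤ 3, NCSeries.PentAt (cruxSeries R χ Z) N := by
  intro N hN
  rcases Nat.lt_or_ge N 3 with hlt | hge
  · exact pentAt_le_two hχ hZ N (by omega)
  · obtain rfl : N = 3 := le_antisymm hN hge
    exact cruxSeries_pentAt_three_of_duality hχ hZ h

/-- Simplex classes only depend on the index (proof irrelevance). [folklore] -/
theorem of_mzvRep_congr {u v : List ℕ} (huv : u = v) (hu : MZV.IsAdmissible u)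
    (hv : MZV.IsAdmissible v) (a : IsSemialgebraicFunOn ℚ (KZ.openOrderedSimplex (MZV.weight u))
      (KZ.mzvIntegrand u)) (b : MeasureTheory.IntegrableOn (KZ.mzvIntegrand u)
      (KZ.openOrderedSimplex (MZV.weight u)) MeasureTheory.volume)
    (a' : IsSemialgebraicFunOn ℚ (KZ.openOrderedSimplex (MZV.weight v)) (KZ.mzvIntegrand v))
    (b' : MeasureTheory.IntegrableOn (KZ.mzvIntegrand v) (KZ.openOrderedSimplex (MZV.weight v))
      MeasureTheory.volume) :
    KZ.of (KZ.mzvRep u hu a b) = KZ.of (KZ.mzvRep v hv a' b') := by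
  subst huv; rfl

omit [Algebra ℚ R] in
/-- **The support item `DualityInKZ` (one change of variables per index) gives `χ⟦ζ(3)⟧ = χ⟦ζ(2,1)⟧`
in every realisation** (`(3)† = (2,1)`). [cite: Zagier1994, §9] -/
theorem chi_Z3_eq_Z21_of_dualityInKZ (hD : DualityInKZ) (hχ : IsRealisation R χ)
    (hZ : AgreesWithSimplex Z) : χ (Z [3]) = χ (Z [2, 1]) := by
  have h := hχ.rel _ (hD [3] (by decide))
  rw [map_sub, sub_eq_zero] at h
  rw [hZ [3] (by decide), hZ [2, 1] (by decide), h]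
  exact congrArg χ (of_mzvRep_congr (by decide) _ _ _ _ _ _)

/-- **GIVEN `DualityInKZ`, THE CRUX HOLDS UNCONDITIONALLY MODULO WEIGHT 4**: for every realisation
`χ` and agreeing `Z`, `Φ_χ` satisfies the pentagon identity in all truncations `N ≤ 3`.  So once the
(provable-now) duality move is landed, the first rung at which `PentagonInKZ` can fail — or needs a
genuinely two-dimensional move — is weight 4 (the stuffle / `5⟦ζ(4)⟧ = 2⟦ζ(2)⟧²` content of
`weight_four_content`). [cite: Furusho2011, §2] -/
theorem pentAt_le_three_of_dualityInKZ (hD : DualityInKZ) (hχ : IsRealisation R χ)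
    (hZ : AgreesWithSimplex Z) : ∀ N ≤ 3, NCSeries.PentAt (cruxSeries R χ Z) N :=
  pentAt_le_three_of_duality hχ hZ (chi_Z3_eq_Z21_of_dualityInKZ hD hχ hZ)

end Crux

end Summit.KontsevichZagierPeriods.FurushoPentagon.PentagonInKZNegative
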